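import Literature.MathematicalPhysics.QuantumFieldTheory.Balaban1983to89.B8Thm2TorusCoverJunctionWindows
import Literature.MathematicalPhysics.QuantumFieldTheory.Balaban1983to89.B9Thm32CinvAtMemberOfCubeDataThmD

/-!
# [B8] Theorem 2 on the torus, cover interface: the `G′`- and `C`-members (Gₛ), (Cₛ) of the form of record DISCHARGED from [B8] Proposition 6 via
# [B9] Corollary 3.6's per-cube (3.35) data and [B9] Theorems 3.7 ∕ 3.9 (+ Theorem D) — the per-member binder displays M5.7's (1ₛ), (Eₛ) ONLY
# (sub-row G-B8-T2S, seat t2s-1 gen 12)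

T. Bałaban, *Spaces of regular gauge field configurations on a lattice and gauge fixing conditions*, Commun. Math. Phys. **99** (1985) 75–102
[`Balaban1985RegularSpaces`, "[B8]"]: Thm 2 p. 83, (1.33)–(1.39) pp. 82–83, p. 82 («We will see later that this condition is a consequence of the first one in
(1.33), so eventually we will drop it out of the assumptions»), Prop. 6 (1.135)–(1.138) p. 99, p. 98 («we take a size of □ equal to MLʲη»), p. 77 («Ω_j = T_η for
j = 0,1,…,l»).  T. Bałaban, *Propagators for lattice gauge theories in a background field*, Commun. Math. Phys. **99** (1985) 389–434
[`Balaban1985BackgroundPropagators`, "[B9]"]: (3.35)–(3.37) p. 396 (the cube class), Cor. 3.6 p. 408, Thm 3.7 (3.87)–(3.90) pp. 409–410, Thm 3.9 p. 413 («For M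
sufficiently large … Theorem 3.2 holds»), (3.95)–(3.97) pp. 411–412, Thm 3.1 (3.42) p. 397, Thm 3.2 (3.48) p. 398, Thm 3.11 p. 416.  [4] = [`Balaban1984PropagatorsII`]
(2.1)–(2.4) p. 224, Lemma 2.1 (2.60)–(2.63) p. 234.  [`Balaban1985Averaging`, "[B7]"] Prop. 2 p. 26.  [`Balaban1985UV3`] (1)–(3) p. 256.

statement-level skeleton of published theorems with citation tags; proofs where landed; nothing here is a claim about the Yang–Mills mass gap

WHY THIS FILE (cell `lit-balaban`; seat t2s-1 gen 12).  The torus Thm 2 cover interface OF RECORD, `B8Thm2TorusCoverJunctionWindows.hThm2Cover_of_prop6_eBlockSymG_final`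
(t2s-1 g10), displays per shape-member FOUR statements: (1ₛ) `IsUnit Δ_a(U; parSymY)` and (Eₛ) the (3.42) block of `G_a = Δ_a⁻¹` (module M5.7's currency), (Gₛ)
the (3.42) block of the site letter `G′(U) = GpY i parSymY U` (M5.5's currency, constant `K_G`, rate `δ₀`) and (Cₛ) the (3.48) majorant of
`C(U) = (Q′G′²Q′*)⁻¹(U)` (M5.6's currency, `K_T`, `δ₀`).  The tree ALREADY proves (Gₛ) and (Cₛ) from ONE family of per-cube (3.35) data (Cor. 3.6's gauges
`u_□` and potentials `A_□`): p33 FILE 9 `B9Cor36GpCoverBindersUnitary.eBlock_GpY_of_cubeData_unitary` (Thm 3.7 ⇒ Thm 3.1 for `G′`) and p21's edition of p33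
FILE 10 with Theorem D discharged, `B9Thm32CinvAtMemberOfCubeDataThmD.cinv_at_member_of_cubeData_thmD` (Thms 3.7 + 3.9 + D ⇒ Thm 3.2 for `C`); and t2s-1 g9's
G5 `B8Thm2TorusOfProp6DeltaASide` ALREADY produces that data family at every constant-level member from [B8] Prop. 6 (pub-ymgap's unconditional
`B8Prop6Reg335ZdAllTorus.prop6At_bgZd_allTorus_holds`) through the carrier bridge G4 `B9Eq335CubeDatumOfReg335Zd.cubeDatum_of_reg335Zd` — but only INSIDE the
proof of its §2.  THIS FILE exposes that production as a theorem (§1), books the member thresholds of FILES 9∕10 above one big-block exponent (§2), and composes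
(§3): the form of record with (Gₛ), (Cₛ) SUPPLIED — the per-member binder displays (1ₛ) ∧ (Eₛ) only, the inputs `δ₀, K_G, K_T` are gone, and ONE numeric window is
added on the consumer's `a_T`: `a_T ≤ c_P`, [B8] Prop. 6's «for α₀ sufficiently small» ((1.135) `Mα₀ ≤ c₆` at the block parameter `M = 10·L·L^{a′}`, together
with the (3.37) size `α₁(□) ≤ min(a₁, ¼)` of FILES 9∕10), `c_P > 0` existential right after `∀ a′ ≥ A₀`.

WHAT THIS FILE PROVES (THEOREMS; 0 `def`, 0 `def … : Prop`, 0 sorry; standard axioms).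
* §1 ★★ `exists_cubeData_of_prop6` — for `1 ≤ N`, `d + 1 ≥ 2`, odd `L = ℓ + 1 ≥ 5`, a big-block exponent `a` and a size `a₁ > 0`: `∃ c_P > 0` such that at every
  constant-level member `i` (`lev ≡ n`, `i.k = n + 1`, `M_h = L^a`), for every `U(N)`-valued `U₀` on `ℤ^{d+1}` periodic in the member's period letter, every
  spacing `η > 0` and every `0 < α₀ ≤ c_P` with `U₀ ∈ 𝔄_n(T_η, α₀)` (`InAk`), THERE IS a family of per-cube (3.35) data `(u_□, A_□, Q_□, C_□, ξ_□, Λ_□)_□` for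
  `bgY i U₀` with E2-6's twelve clauses VERBATIM (the common input of FILES 9∕10: bi-contractive `u_□`, `Q_□ ⊇ NearC_□(35S_j∕8 + 1)`, `(bgY i U₀)^{u_□} = e^{iηA_□}`
  on the bonds of `Q_□`, `‖A_□‖ ≦ C_□ξ_□⁻¹`, `‖η⁻¹∂A_□‖ ≦ C_□ξ_□⁻²`, `0 < ξ_□ ≦ 5S_jη`, `L^{j+1}η ≦ Λ_□ξ_□`, `1 ≦ Λ_□`, `max C_□ (C_□(1+D₁θ))Λ_□² ≦ a₁`, `≦ ¼`) —
  t2s-1 g9 G5 :259–324 as a theorem (Prop. 6 at the all-torus member `torusIdx ⟨η, n⟩`, block parameter `10·L·M_h`, the aligned `ℤ^{d+1}` cube of side `20S_n`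
  containing the chart ball; `c_P = min (c₆∕(10L·L^a)) (min a₁ ¼ ∕ (c₃₅·(10L·L^a)·K₆·L²·max 1 (1 + D₁θ) + 1))`).
* §2 ★ `exists_threshold_exponent` — for any thresholds `M₀, T₀ : ℝ`, `N₀ : ℕ` there is `A₁` with `M₀ ≤ L·M_h`, `N₀ + 1 ≤ R·(L·M_h)`, `T₀ ≤ RM1 i` at EVERY member
  with `M_h = L^{a′}`, `a′ ≥ A₁` (G1 `exists_exponent_thresholds` at `R = 2L²` and every member's V1 inequality `KIdx.hR2 : 2L² ≤ R`).
* §3 ★★★★★ `hThm2Cover_of_prop6_deltaAMembers` — THE TORUS THM 2 COVER INTERFACE WITH (Gₛ), (Cₛ) DISCHARGED (`d + 1 = 3`, `N = 2`): displayed inputs `4 ≤ ℓ`,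
  `τ = tr` (cyclic, Cauchy–Schwarz constant `C_τ`), `M ≥ 1`, M5.7's rate data `δ_E > 0`, `0 < α < 1`, `len`, a real basis `b` of `M₂(ℂ)` with coordinate bound `M₂`,
  the walk-letter parameters `Rr, Hp, Hg`; conclusion `∃ d′ A₀, ∀ a′ ≥ A₀, ∃ c_P > 0, ∀ B_E > 0, ∃ a_J > 0, ∀ a_T ⟨FILE 4 ∕ F7 windows⟩ (a_T ≤ c_P), ∀ 0 < α₀′ ≤ a_J
  ⟨C₀α₀′ ≤ ⅓, 2α₀′ ≤ c₂′, a_T·L² < α₀′⟩, ∃ a₀′ > 0, ∃ k₀, ∃ c_α > 0, ∀ c_L …, ∃ B₁ B₂ c₁ > 0, ∀ F : T3Family, F.L = ℓ + 1 → ∀ n < K`, [∀ shape-members `i` of the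
  cover torus and admissible `(α₀, U₀)`: (1ₛ) ∧ (Eₛ)] → `P ∣ P′ ∧ L^{K−n} ∣ P ∧ Thm2TorusAt (ℓ+1) (K − n) P′ (eta F n K) 0 B₁ B₂ c₁ len SU(2) ⊤`.
  Proof: FILE 9 and FILE 10-D at `G := U(2)` give `(δ_G, K_G)`, `(δ_C, K_T)`, thresholds and sizes; the form of record is CALLED at `δ₀ := min δ_G δ_C`, `K_G`, `K_T`;
  per member, §1's data at `a₁ := min a₁(9) a₁(10)` feeds FILE 9 (rate weakened by `B9Thm37GpAtCoverLarge.eBlock_mono'`) and FILE 10-D (`B6RandomWalk.hasMajorant_mono`),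
  the section of `β` is `Function.surjInv` (G9 §1 `surjective_beta_kIdx_of_constLev`), `bgY i U₀` is `U(2)`-valued (`bgY_mem`), the background family is the
  caller's (FILE 9) ∕ the one-point family (FILE 10-D).
* §4 ★ `exists_admissible_sizes_below` — the displayed `a_T` ∕ `α₀′` windows of §3, including the new `a_T ≤ c_P`, are jointly inhabited for every `a_J, c_P > 0`
  (t2s-1 g10's `exists_admissible_sizes` with `a_T ↦ min a_T c_P`).

HONEST SCOPE ∕ NOT CLAIMED.  Composition BY NAME of landed theorems with threshold ∕ rate bookkeeping; NO estimate of [B8] ∕ [B9] ∕ [4] is proved IN THIS FILE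
([B8] Prop. 6 is pub-ymgap's theorem; Cor. 3.6 ∕ Thm 3.7 ∕ Thm 3.9 ∕ Thm 3.11 ∕ Theorem D are p33's ∕ p21's ∕ dag-n06's files; the bond-sector junction and the
windows are t2s-1 g10's).  STILL DISPLAYED per shape-member: (1ₛ) `IsUnit Δ_a(bgY i U₀; parSymY)` and (Eₛ) `EBlock (kernelFamilyBInv i B cfg (GAY i (parSymY i)
(parBY i) (GpY i (parSymY i))) par) B_E δ_E U₁` for every background family through `bgY i U₀` — module M5.7's endpoint currency ([B9] Thm 3.10 ⇒ Thm 3.3 for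
`G = Δ_a⁻¹`; its families 2–4 of (3.105) are the FAMTHREE ∕ FAMFOUR ∕ ZETA-2 lanes of p33 ∕ p38, cell GAPS G-B9-05 ff.) — inhabited by NOTHING here.  Numeric windows
displayed as in the form of record plus `a_T ≤ c_P`; DESIGN constants (`M := 10·L·M_h`, side `20S_j`, `c_P`, `δ₀ := min δ_G δ_C` — print's «a decay rate
arbitrarily close» not pursued); `SU(2)`, `d + 1 = 3` (the form of record's); sup-entries only; count-neutral; no summit ∕ sub-problem ∕ node statement is proved;
`stub_PV3A` NOT discharged; nothing continuum ∕ ℝ⁴ ∕ OS ∕ Clay — the Yang–Mills mass gap is NOT proved by any of this (Track A conditional rung).  No `sorry`, no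
`axiom`, no `… : Prop` fact, no `instance`, no `notation`, no `def`.  NEW file; nothing landed is modified.  `--supports stmt-QuantumFields-19200` as helper.
Net new unproved facts: 0.

REUSED BY NAME: t2s-1 g9 G5 `B8Thm2TorusOfProp6DeltaASide.reg335Cube_ball_of_prop6At`, G4 `B9Eq335CubeDatumOfReg335Zd.cubeDatum_of_reg335Zd`, G1
`B8Thm2TorusMemberCatalogueThresholds.exists_exponent_thresholds`, G9 `B8Thm2TorusCoverOfEBlock.surjective_beta_kIdx_of_constLev`, t2s-1 g10
`B8Thm2TorusCoverJunctionWindows.hThm2Cover_of_prop6_eBlockSymG_final`; pub-ymgap `B8Prop6Reg335ZdAllTorus.prop6At_bgZd_allTorus_holds`; p33 FILE 9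
`B9Cor36GpCoverBindersUnitary.eBlock_GpY_of_cubeData_unitary`; p21 `B9Thm32CinvAtMemberOfCubeDataThmD.cinv_at_member_of_cubeData_thmD`;
`B9Thm37GpAtCoverLarge.eBlock_mono'`, `B6RandomWalk.hasMajorant_mono`, `B8Thm2TorusLettersPerOfKnit.bgY_mem`, `B9Cor36CubeCutoffs.{one_le_SC, nine_le_SC}`.
RELATED, NOT DUPLICATED (searched 2026-08-29: `rg -l 'cinv_at_member_of_cubeData_thmD|hThm2Cover_of_prop6_eBlockSymG_final' Literature/` = the two defining files +
the knit twin `B9Thm32CinvAtKnitLetterOfCubeDataThmD` only; `ls Balaban1983to89 | grep -ci 'CoverGC|GCOfProp6'` = 0): p33 F16 `B8Thm2TorusKnitOfCubeData` + t2s-1 g9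
G2∕G3∕G5 (the same cube data feeding the KNIT-letter road `KnitMajorants` ∕ `B9P3PerAt`, superseded as interface by the cover form; files untouched).
-/

noncomputable section

open scoped BigOperators

namespace Literature.MathematicalPhysics.QuantumFieldTheory.Balaban1983to89.B8Thm2TorusCoverGCOfProp6

/-! ## §1 ★★ [B8] Prop. 6 ⇒ Cor. 3.6's per-cube (3.35) data family at every constant-level member (t2s-1 g9 G5 :259–324 as a theorem) -/

section CubeData

open Node00 B6KLevelCensusIndexV1 B9Eq39Adjoint
open B7Prop1Explicit renaming Site → LSite
open B7Prop1Explicit (e)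
open B7Prop2Explicit (unitaryUnits)
open B4PartitionUnity22 (thetaProf D1)
open B6Cover236MultiLevelBlocks (cubes)
open B6GlobalChartV1 (PV boxEquiv)
open B9BackgroundsKLevelV1 (shiftsV1)
open B9Eq360DeltaPrimeAY (AfldY)
open B9Cor36CubeCutoffs (SC NearC one_le_SC nine_le_SC)
open B8Ineq132 (InAk)
open B8Thm2TorusLettersPerOfKnit (bgY)
open B8Thm2TorusOfProp6DeltaASide (reg335Cube_ball_of_prop6At)
open B9Eq335CubeDatumOfReg335Zd (cubeDatum_of_reg335Zd)
open B8Prop6Reg335ZdAllTorus (prop6At_bgZd_allTorus_holds)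
open scoped Matrix Matrix.Norms.L2Operator

variable {d ℓ : ℕ} {hd : 1 ≤ d + 1} {hL : Odd (ℓ + 1) ∧ 1 < ℓ + 1} {b₀ b₁ : ℝ}
variable {N : ℕ} [NeZero N]

/-- ★★ **[B8] PROPOSITION 6 ⇒ COROLLARY 3.6's PER-CUBE (3.35) DATA FAMILY AT EVERY CONSTANT-LEVEL MEMBER** (t2s-1 g9 G5's inline production, exposed).  For `1 ≤ N`,
`d + 1 ≥ 2`, odd `L = ℓ + 1 ≥ 5`, a big-block exponent `a` and a (3.37) size `a₁ > 0` there is `c_P > 0` such that: at every member `i` of constant level `n` with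
`i.k = n + 1`, `M_h = L^a`, for every `U(N)`-valued `U₀` on `ℤ^{d+1}` periodic in the member's period letter `P′ = (PV d ℓ i.m i.K).sitesPerDir 0`, every spacing
`η > 0` and every `0 < α₀ ≤ c_P` with `U₀ ∈ 𝔄_n(T_η, α₀)`, there are bi-contractive gauges `u_□`, potentials `A_□`, torus sets `Q_□ ⊇ NearC_□(35S_j∕8 + 1)` and
constants `C_□ ≥ 0`, `0 < ξ_□ ≦ 5S_jη_i`, `1 ≦ Λ_□` with `L^{j+1}η_i ≦ Λ_□ξ_□`, `(bgY i U₀)^{u_□} = e^{iη_iA_□}` on the bonds of `Q_□`, `‖A_□‖ ≦ C_□ξ_□⁻¹`,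
`‖η_i⁻¹∂A_□‖ ≦ C_□ξ_□⁻²` on `Q_□`, and `max C_□ (C_□(1+D₁θ))Λ_□² ≦ a₁`, `≦ ¼` — E2-6's ∕ FILE 9's twelve clauses verbatim.  Prop. 6 is read at the all-torus member
`torusIdx ⟨η, n⟩` with block parameter `M := 10·L·M_h` on the aligned `ℤ^{d+1}` cube of side `20S_n` containing the chart ball (G5 §1), then G4's carrier bridge;
`c_P = min (c₆∕(10L·L^a)) (min a₁ ¼ ∕ (c₃₅·(10L·L^a)·K₆·L²·max 1 (1+D₁θ) + 1))` (DESIGN constant; `c₃₅, c₆, K₆` = Prop. 6's existential constants).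
[cite: Balaban1985RegularSpaces, Prop. 6 (1.135)–(1.138) p.99, p.98 («we take a size of □ equal to MLʲη»), (1.33) p.82, p.82 («eventually we will drop it out of the assumptions»), p.77 («Ω_j = T_η»); Balaban1985BackgroundPropagators, (3.35)–(3.37) p.396, Cor. 3.6 p.408 l.1–10 + l.20–25; Balaban1984PropagatorsII, (2.1)–(2.4) p.224] -/
theorem exists_cubeData_of_prop6 (hd2 : 2 ≤ d + 1) (hℓ : 4 ≤ ℓ) (a : ℕ) {a₁ : ℝ} (ha₁ : 0 < a₁) :
    letI : CStarAlgebra (Matrix (Fin N) (Fin N) ℂ) := {}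
    ∃ cP : ℝ, 0 < cP ∧ ∀ (i : KIdx d ℓ hd hL b₀ b₁) (n : ℕ), (∀ x, i.D.lev x = n) → i.k = n + 1 → i.Mh = (ℓ + 1) ^ a →
    ∀ (η α₀ : ℝ) (U₀ : LSite (d + 1) → Fin (d + 1) → (Matrix (Fin N) (Fin N) ℂ)ˣ),
    (∀ x κ, U₀ x κ ∈ unitaryUnits (Matrix (Fin N) (Fin N) ℂ)) →
    (∀ (x : LSite (d + 1)) (μ : Fin (d + 1)), U₀ (x + (((PV d ℓ i.m i.K hd hL).sitesPerDir 0 : ℕ) : ℤ) • e μ) = U₀ x) →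
    0 < η → 0 < α₀ → α₀ ≤ cP → InAk (ℓ + 1) n η α₀ (fun _ => (Set.univ : Set (LSite (d + 1)))) U₀ →
    ∃ (g : ↥(cubes (toKT i).D.toDomains) → GaugeY (Matrix (Fin N) (Fin N) ℂ) i) (A : ↥(cubes (toKT i).D.toDomains) → AfldY (Matrix (Fin N) (Fin N) ℂ) i)
      (Q : ↥(cubes (toKT i).D.toDomains) → Set (Site (PV d ℓ i.m i.K hd hL) 0)) (C ξ Λ : ↥(cubes (toKT i).D.toDomains) → ℝ),
      (∀ c x, ‖(g c x : Matrix (Fin N) (Fin N) ℂ)‖ ≤ 1 ∧ ‖(((g c x)⁻¹ : (Matrix (Fin N) (Fin N) ℂ)ˣ) : Matrix (Fin N) (Fin N) ℂ)‖ ≤ 1) ∧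
      (∀ c, 0 ≤ C c) ∧ (∀ c, 0 < ξ c) ∧ (∀ c, 1 ≤ Λ c) ∧ (∀ c, ξ c ≤ 5 * (SC i c : ℝ) * (kGeo i).eta) ∧
      (∀ c, LatticeNorms.scaleLen ((ℓ : ℝ) + 1) (kGeo i).eta (c.1.1 + 1) ≤ Λ c * ξ c) ∧
      (∀ c, ∀ x : Site (PV d ℓ i.m i.K hd hL) 0, NearC i c (35 * SC i c / 8 + 1) (boxEquiv i.hN x).1 → x ∈ Q c) ∧
      (∀ c, ∀ (κ : Fin (d + 1)) (x : Site (PV d ℓ i.m i.K hd hL) 0), x ∈ Q c → x.shift κ ∈ Q c →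
        gaugeY i (g c) (bgY i U₀) κ x = fluct (kGeo i).eta (A c) κ x) ∧
      (∀ c, ∀ κ, ∀ x ∈ Q c, ‖A c κ x‖ ≤ C c * (ξ c)⁻¹) ∧
      (∀ c, ∀ μ ν, ∀ x ∈ Q c,
        ‖(((kGeo i).eta : ℂ)⁻¹) • covD (shiftsV1 (PV d ℓ i.m i.K hd hL)) (fun _ _ => (1 : (Matrix (Fin N) (Fin N) ℂ)ˣ)) μ (A c ν) x‖ ≤ C c * (ξ c ^ 2)⁻¹) ∧
      (∀ c, max (C c) (C c * (1 + D1 thetaProf)) * Λ c ^ 2 ≤ a₁) ∧ (∀ c, max (C c) (C c * (1 + D1 thetaProf)) * Λ c ^ 2 ≤ 1 / 4) := by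
  letI : CStarAlgebra (Matrix (Fin N) (Fin N) ℂ) := {}
  haveI : Nonempty (Fin N) := ⟨⟨0, Nat.pos_of_ne_zero (NeZero.ne N)⟩⟩
  -- [B8] Prop. 6 at the all-torus members (pub-ymgap, unconditional)
  obtain ⟨c35, c₆, K₆, hc35, hc₆, hK₆, hP6⟩ :=
    prop6At_bgZd_allTorus_holds (𝔸 := Matrix (Fin N) (Fin N) ℂ) (d := d + 1) hd2 (L := ℓ + 1) (by omega) hL.1
  -- the smallness threshold for Prop. 6 at `M_h = L^a`: `MP = 10·L·L^a`
  set Lr : ℝ := ((ℓ + 1 : ℕ) : ℝ) with hLr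
  set MP : ℝ := ((10 * (ℓ + 1) * (ℓ + 1) ^ a : ℕ) : ℝ) with hMP
  have hMP0 : 0 < MP := by rw [hMP]; positivity
  set D : ℝ := max 1 (1 + D1 thetaProf) with hDdef
  have hD1 : 1 ≤ D := le_max_left _ _
  have hD0 : 0 < D := lt_of_lt_of_le one_pos hD1
  set cP : ℝ := min (c₆ / MP) (min a₁ (1 / 4) / (c35 * MP * K₆ * Lr ^ 2 * D + 1)) with hcP
  have hden : 0 < c35 * MP * K₆ * Lr ^ 2 * D + 1 := by positivity
  have hcP0 : 0 < cP := lt_min (div_pos hc₆ hMP0) (div_pos (lt_min ha₁ (by norm_num)) hden)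
  refine ⟨cP, hcP0, ?_⟩
  intro i n hD hkn hMh η α₀ U₀ hU₀ hU₀per' hη hα₀ hα₀c hAk
  -- per cube
  have hcube : ∀ c : ↥(cubes (toKT i).D.toDomains),
      ∃ (g : GaugeY (Matrix (Fin N) (Fin N) ℂ) i) (A : AfldY (Matrix (Fin N) (Fin N) ℂ) i) (Q : Set (Site (PV d ℓ i.m i.K hd hL) 0)) (C ξ Λ : ℝ),
      (∀ x, ‖(g x : Matrix (Fin N) (Fin N) ℂ)‖ ≤ 1 ∧ ‖(((g x)⁻¹ : (Matrix (Fin N) (Fin N) ℂ)ˣ) : Matrix (Fin N) (Fin N) ℂ)‖ ≤ 1) ∧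
      0 ≤ C ∧ 0 < ξ ∧ 1 ≤ Λ ∧ ξ ≤ 5 * (SC i c : ℝ) * (kGeo i).eta ∧
      LatticeNorms.scaleLen ((ℓ : ℝ) + 1) (kGeo i).eta (c.1.1 + 1) ≤ Λ * ξ ∧
      (∀ x : Site (PV d ℓ i.m i.K hd hL) 0, NearC i c (35 * SC i c / 8 + 1) (boxEquiv i.hN x).1 → x ∈ Q) ∧
      (∀ (κ : Fin (d + 1)) (x : Site (PV d ℓ i.m i.K hd hL) 0), x ∈ Q → x.shift κ ∈ Q →
        gaugeY i g (bgY i U₀) κ x = fluct (kGeo i).eta A κ x) ∧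
      (∀ κ, ∀ x ∈ Q, ‖A κ x‖ ≤ C * ξ⁻¹) ∧
      (∀ μ ν, ∀ x ∈ Q,
        ‖(((kGeo i).eta : ℂ)⁻¹) • covD (shiftsV1 (PV d ℓ i.m i.K hd hL)) (fun _ _ => (1 : (Matrix (Fin N) (Fin N) ℂ)ˣ)) μ (A ν) x‖ ≤ C * (ξ ^ 2)⁻¹) ∧
      max C (C * (1 + D1 thetaProf)) * Λ ^ 2 ≤ a₁ ∧ max C (C * (1 + D1 thetaProf)) * Λ ^ 2 ≤ 1 / 4 := by
    intro c
    -- the cube's level is the member's constant level `n`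
    have hjn : c.1.1 = n := by
      obtain ⟨x, _, hx⟩ := Finset.mem_image.1 c.2
      have h1 : c.1.1 = (toKT i).D.lev x := (congrArg Prod.fst hx).symm
      rw [h1]; exact hD x
    -- Prop. 6's datum on the aligned cube containing the chart ball
    have hMhℕ : (toKT i).Mh = (ℓ + 1) ^ a := hMh
    have hsmall : ((10 * (ℓ + 1) * (toKT i).Mh : ℕ) : ℝ) * α₀ ≤ c₆ := by
      rw [hMhℕ, ← hMP]
      have h1 : α₀ ≤ c₆ / MP := hα₀c.trans (min_le_left _ _)
      rw [le_div_iff₀ hMP0] at h1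
      linarith
    have hAj : InAk (ℓ + 1) c.1.1 η α₀ (fun _ => (Set.univ : Set (LSite (d + 1)))) U₀ := by rw [hjn]; exact hAk
    obtain ⟨B, hB, h335⟩ := reg335Cube_ball_of_prop6At (hd := hd) (hL := hL) hP6 i c hη hα₀ hsmall hU₀ hAj
    -- the constant `C_Z = c35 · MP · K₆ · α₀`
    set CZ : ℝ := c35 * ((10 * (ℓ + 1) * (toKT i).Mh : ℕ) : ℝ) * (K₆ * α₀) with hCZ
    have hCZ' : CZ = c35 * MP * K₆ * α₀ := by rw [hCZ, hMhℕ, ← hMP]; ring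
    have hCZ0 : 0 ≤ CZ := by rw [hCZ']; positivity
    -- the (3.37) sizes from `α₀ ≤ c_P`
    have hkey : CZ * Lr ^ 2 * D ≤ min a₁ (1 / 4) := by
      have h1 : α₀ ≤ min a₁ (1 / 4) / (c35 * MP * K₆ * Lr ^ 2 * D + 1) := hα₀c.trans (min_le_right _ _)
      rw [le_div_iff₀ hden] at h1
      have h2 : CZ * Lr ^ 2 * D = α₀ * (c35 * MP * K₆ * Lr ^ 2 * D) := by rw [hCZ']; ring
      rw [h2]
      nlinarith [hα₀.le]
    have hmax : max (CZ * Lr ^ 2) (CZ * Lr ^ 2 * (1 + D1 thetaProf)) ≤ CZ * Lr ^ 2 * D := by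
      refine max_le ?_ ?_
      · have : CZ * Lr ^ 2 * 1 ≤ CZ * Lr ^ 2 * D := mul_le_mul_of_nonneg_left hD1 (by positivity)
        linarith
      · exact mul_le_mul_of_nonneg_left (le_max_right _ _) (by positivity)
    have hsz₁ : max (CZ * Lr ^ 2) (CZ * Lr ^ 2 * (1 + D1 thetaProf)) ≤ a₁ := hmax.trans (hkey.trans (min_le_left _ _))
    have hsz₄ : max (CZ * Lr ^ 2) (CZ * Lr ^ 2 * (1 + D1 thetaProf)) ≤ 1 / 4 := hmax.trans (hkey.trans (min_le_right _ _))
    -- the room inequality: `N = M_h·L^{k+1}·P′ ≥ 25 S_n`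
    have hroom : (35 * SC i c / 8 + 3) * 2 ≤ (((PV d ℓ i.m i.K hd hL).sitesPerDir 0 : ℕ) : ℤ) := by
      have hSC9 := nine_le_SC i c
      have hNB : B6MultiLevelBoxOperator.N0 ℓ i.Mh i.k i.P' 0 = (PV d ℓ i.m i.K hd hL).sitesPerDir 0 := i.hN 0
      have hP5 : 5 ≤ i.P' 0 := i.hP5 0
      have h25 : 5 * 5 ≤ (ℓ + 1) * i.P' 0 := Nat.mul_le_mul (by omega) hP5
      have hNnat : 25 * (i.Mh * (ℓ + 1) ^ (n + 1)) ≤ B6MultiLevelBoxOperator.N0 ℓ i.Mh i.k i.P' 0 := by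
        show 25 * (i.Mh * (ℓ + 1) ^ (n + 1)) ≤ (ℓ + 1) ^ i.k * ((ℓ + 1) * (i.Mh * i.P' 0))
        rw [hkn]
        calc 25 * (i.Mh * (ℓ + 1) ^ (n + 1)) ≤ ((ℓ + 1) * i.P' 0) * (i.Mh * (ℓ + 1) ^ (n + 1)) := Nat.mul_le_mul_right _ h25
          _ = (ℓ + 1) ^ (n + 1) * ((ℓ + 1) * (i.Mh * i.P' 0)) := by ring
      rw [hNB] at hNnat
      have hSC : SC i c = ((i.Mh * (ℓ + 1) ^ (n + 1) : ℕ) : ℤ) := by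
        show ((B6MultiLevelBoxOperator.bigSide ℓ (toKT i).Mh c.1.1 : ℕ) : ℤ) = _
        rw [hjn]; rfl
      have hN' : ((25 * (i.Mh * (ℓ + 1) ^ (n + 1)) : ℕ) : ℤ) ≤ (((PV d ℓ i.m i.K hd hL).sitesPerDir 0 : ℕ) : ℤ) := Int.ofNat_le.mpr hNnat
      rw [Nat.cast_mul, ← hSC] at hN'
      omega
    exact cubeDatum_of_reg335Zd i c hU₀per' hη hCZ0 hsz₁ hsz₄ hroom hB h335
  choose g A Q C ξ Λ hg hC hξ hΛ hξS hΛξ hQ hgA hAb hdA hs₁ hs₄ using hcube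
  exact ⟨g, A, Q, C, ξ, Λ, fun c x => hg c x, hC, hξ, hΛ, hξS, hΛξ, hQ, hgA, hAb, hdA, hs₁, hs₄⟩

end CubeData

/-! ## §2 ★ FILES 9∕10's member thresholds above one big-block exponent -/

section Thresholds

open Node00 (toKT)
open B6KLevelCensusIndexV1 (KIdx)
open B9CubeGeometryInputs (RM1)
open B8Thm2TorusMemberCatalogueThresholds (exists_exponent_thresholds)

variable {d ℓ : ℕ} {hd : 1 ≤ d + 1} {hL : Odd (ℓ + 1) ∧ 1 < ℓ + 1} {b₀ b₁ : ℝ}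

/-- ★ **THE MEMBER THRESHOLDS OF FILES 9∕10 ABOVE ONE EXPONENT**: for any `M₀ T₀ : ℝ`, `N₀ : ℕ` there is `A₁` such that every member `i` with `M_h = L^{a′}`, `a′ ≥ A₁`,
has `M₀ ≤ L·M_h`, `N₀ + 1 ≤ R·(L·M_h)` and `T₀ ≤ RM1 i` (G1's exponent at `R = 2L²`, every member's V1 inequality `2L² ≤ R`, monotonicity in `a′`).
[cite: Balaban1985BackgroundPropagators, Thm 3.7 p.409 («For M sufficiently large»), Thm 3.9 p.413; Balaban1984PropagatorsII, (2.1)–(2.2) p.224, Lemma 2.1 p.234 («for RM satisfying (2.59)»), bookkeeping] -/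
theorem exists_threshold_exponent (hℓ : 2 ≤ ℓ) (M₀ T₀ : ℝ) (N₀ : ℕ) :
    ∃ A₁ : ℕ, ∀ a' : ℕ, A₁ ≤ a' → ∀ i : KIdx d ℓ hd hL b₀ b₁, i.Mh = (ℓ + 1) ^ a' →
      M₀ ≤ ((ℓ : ℝ) + 1) * (toKT i).Mh ∧ N₀ + 1 ≤ (toKT i).R * ((ℓ + 1) * (toKT i).Mh) ∧ T₀ ≤ RM1 i := by
  obtain ⟨A₁, -, hM, hN, hT⟩ := exists_exponent_thresholds ℓ hℓ M₀ T₀ N₀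
  refine ⟨A₁, fun a' ha' i hMh => ?_⟩
  have hpow : (ℓ + 1) ^ A₁ ≤ (ℓ + 1) ^ a' := Nat.pow_le_pow_right (Nat.succ_pos ℓ) ha'
  have hMhi : (toKT i).Mh = (ℓ + 1) ^ a' := hMh
  have hRi : 2 * (ℓ + 1) ^ 2 ≤ (toKT i).R := i.hR2
  -- the natural-number product is monotone
  have hprod : 2 * (ℓ + 1) ^ 2 * ((ℓ + 1) * (ℓ + 1) ^ A₁) ≤ (toKT i).R * ((ℓ + 1) * (toKT i).Mh) := by
    rw [hMhi]
    exact Nat.mul_le_mul hRi (Nat.mul_le_mul_left _ hpow)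
  refine ⟨?_, hN.trans hprod, ?_⟩
  · calc M₀ ≤ ((ℓ : ℝ) + 1) * (((ℓ + 1) ^ A₁ : ℕ) : ℝ) := hM
      _ ≤ ((ℓ : ℝ) + 1) * (((ℓ + 1) ^ a' : ℕ) : ℝ) := by
          exact mul_le_mul_of_nonneg_left (by exact_mod_cast hpow) (by positivity)
      _ = ((ℓ : ℝ) + 1) * (toKT i).Mh := by rw [hMhi]
  · calc T₀ ≤ ((2 * (ℓ + 1) ^ 2 * ((ℓ + 1) * (ℓ + 1) ^ A₁) - 1 : ℕ) : ℝ) := hT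
      _ ≤ RM1 i := by
          unfold RM1
          exact_mod_cast Nat.sub_le_sub_right hprod 1

end Thresholds

/-! ## §3 ★★★★★ The torus Thm 2 cover interface with (Gₛ), (Cₛ) DISCHARGED: the per-member binder displays (1ₛ) ∧ (Eₛ) only -/

section Cover

open Node00 B6KLevelCensusIndexV1
open B7Prop1Explicit renaming Site → LSite
open B7Prop1Explicit (e)
open B7Prop2Explicit (unitaryUnits C0 c2')
open B6GlobalChartV1 (PV)
open B6Ineq2142KLevelV1 (β)
open B6RandomWalk (HasMajorant hasMajorant_mono)
open B9Thm34Ext (toB6)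
open B9FromB6 (EBlock)
open B9CubeLettersInvReadings (kernelFamilyBInv kernelFamilySInv)
open B9GeoNormsKLevelV1 (geo9K)
open B9GeoLemma21KLevelV1 (geo9K_dist_nonneg')
open B9Eq352DivFormLetters (conj)
open B8Thm2TorusCoverJunctionWindows (hThm2Cover_of_prop6_eBlockSymG_final)
open B8Thm2TorusCoverOfEBlock (surjective_beta_kIdx_of_constLev)
open B8Ineq132 (InAk)
open B8Thm2TorusLettersPerOfKnit (bgY bgY_mem)
open B9Eq316AveragingTransposeZd (betaTau alphaQ)
open B7Prop2SpecialUnitary (specialUnitaryUnits)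
open B8Thm2TorusAt (Thm2TorusAt)
open T4TermwiseTorus (IsPeriodic)
open T3ContinuumYM3Torus (T3Family)
open T3SectALandauChart (eta eta_pos)
open B9Cor36GpCoverBindersUnitary (eBlock_GpY_of_cubeData_unitary)
open B9Thm32CinvAtMemberOfCubeDataThmD (cinv_at_member_of_cubeData_thmD)
open B9Thm37GpAtCoverLarge (eBlock_mono')
open scoped Matrix Matrix.Norms.L2Operator

variable {ℓ : ℕ} {hL : Odd (ℓ + 1) ∧ 1 < ℓ + 1} {hd₃ : 1 ≤ 2 + 1}
variable [instF : ∀ i : KIdx 2 ℓ hd₃ hL 1 1, Fintype (geo9K i).Site] [instD : ∀ i : KIdx 2 ℓ hd₃ hL 1 1, DecidableEq (geo9K i).Site]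

/-- ★★★★★ **THE TORUS THM 2 COVER INTERFACE WITH THE `G′`- AND `C`-MEMBERS DISCHARGED FROM [B8] PROP. 6** (`d + 1 = 3`, `N = 2`): t2s-1 g10's form of record
`B8Thm2TorusCoverJunctionWindows.hThm2Cover_of_prop6_eBlockSymG_final` with (Gₛ) supplied by p33 FILE 9 (`eBlock_GpY_of_cubeData_unitary`, [B9] Thm 3.7 ⇒ Thm 3.1
for `G′(U) = GpY i parSymY U`) and (Cₛ) by p21's FILE 10-D (`cinv_at_member_of_cubeData_thmD`, Thms 3.7 + 3.9 + D ⇒ Thm 3.2 (3.48) for `(Q′G′²Q′*)⁻¹(U)`), both fed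
§1's per-cube (3.35) data from [B8] Prop. 6.  DISPLAYED INPUTS: `4 ≤ ℓ`; `τ = tr` with its cyclicity and a Cauchy–Schwarz constant `C_τ`; `M ≥ 1`; M5.7's rate data
`δ_E > 0`, `0 < α < 1`; `len`; a real basis `b` of `M₂(ℂ)` with coordinate bound `M₂`; the walk-letter parameters `Rr, Hp, Hg`.  CONCLUSION: `∃ d′ A₀, ∀ a′ ≥ A₀,
∃ c_P > 0, ∀ B_E > 0, ∃ a_J > 0, ∀ a_T ⟨FILE 4 ∕ F7 windows⟩, a_T ≤ c_P → ∀ 0 < α₀′ ≤ a_J ⟨C₀α₀′ ≤ ⅓, 2α₀′ ≤ c₂′, a_T·L² < α₀′⟩, ∃ a₀′ > 0, ∃ k₀, ∃ c_α > 0, ∀ c_L …,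
∃ B₁ B₂ c₁ > 0, ∀ F : T3Family, F.L = ℓ + 1 → ∀ n < K`, [for every shape-member `i` of the cover torus `PV 2 ℓ (F.m + k₀) K` (`i.k = m′+1`, constant level
`1 ≤ m′ ≤ K − n`, `M_h = L^{a′}`, `c_f = L^{m′+1}`, weights of record, period match) and every `U(2)`-valued `P′`-periodic `U₀ ∈ 𝔄_{m′}(T_η, α₀)`, `0 < α₀ ≤ a_T`:
(1ₛ) `IsUnit Δ_a(bgY i U₀; parSymY)` ∧ (Eₛ) `∀ B cfg par U₁, cfg U₁ = bgY i U₀ → EBlock (kernelFamilyBInv i B cfg (GAY i (parSymY i) (parBY i) (GpY i (parSymY i))) par) B_E δ_E U₁`]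
→ `P ∣ P′ ∧ L^{K−n} ∣ P ∧ Thm2TorusAt (ℓ+1) (K − n) P′ (eta F n K) 0 B₁ B₂ c₁ len SU(2) ⊤`.  The new window `a_T ≤ c_P` is [B8] Prop. 6's «for α₀ sufficiently
small» (`c_P` of §1 at the size `a₁ := min` of FILES 9∕10's).  HONEST SCOPE: (1ₛ), (Eₛ) (M5.7's endpoint currency — [B9] Thm 3.10 ⇒ Thm 3.3 for `G = Δ_a⁻¹`) are
DISPLAYED and inhabited by nothing here; `δ₀ := min δ_G δ_C` and the suppliers' thresholds are DESIGN bookkeeping; `stub_PV3A` NOT discharged; no summit ∕ node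
statement proved; nothing continuum ∕ ℝ⁴ ∕ OS — the Yang–Mills mass gap is NOT proved by any of this.
[cite: Balaban1985RegularSpaces, Thm 2 p.83, (1.29) p.81, (1.33)–(1.39) pp.82–83, p.82 («eventually we will drop it out of the assumptions»), (1.7) p.77, Prop. 6 p.99, (1.58)–(1.60) pp.86–87; Balaban1985Averaging, Prop. 2 p.26, (52)–(53) pp.26–27; Balaban1985BackgroundPropagators, (3.35)–(3.37) p.396, Cor. 3.6 p.408, Thm 3.7 (3.87)–(3.90) pp.409–410, Thm 3.9 p.413, (3.95)–(3.97) pp.411–412, Thm 3.1 (3.42) p.397, Thm 3.2 (3.48) p.398, Thm 3.3 p.399, Thm 3.11 p.416, (3.101) p.414, (3.106) p.414; Balaban1984PropagatorsII, (2.50)–(2.55) p.232, Lemma 2.1 (2.60)–(2.63) p.234, (2.66)–(2.67) p.234; Balaban1985UV3, (1)–(3) p.256] -/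
theorem hThm2Cover_of_prop6_deltaAMembers (hℓ : 4 ≤ ℓ)
    (τ : (Matrix (Fin 2) (Fin 2) ℂ) →ₗ[ℂ] ℂ) (hτ : ∀ a, τ a = Matrix.trace a) (hτt : ∀ a b, τ (a * b) = τ (b * a))
    {Cτ : ℝ} (hCτ : ∀ x y : (Matrix (Fin 2) (Fin 2) ℂ), |(τ (star x * y)).re| ≤ Cτ * ‖x‖ * ‖y‖)
    {M : ℝ} (hM1 : 1 ≤ M) {δE α : ℝ} (hδE : 0 < δE) (hαE0 : 0 < α) (hα1 : α < 1)
    {len : LSite (2 + 1) → ℝ}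
    {ι : Type} [Fintype ι] [DecidableEq ι] (b : Module.Basis ι ℝ (Matrix (Fin 2) (Fin 2) ℂ)) {M₂ : ℝ} (hM₂ : 0 ≤ M₂)
    (hrepr : ∀ (v : (Matrix (Fin 2) (Fin 2) ℂ)) (j : ι), |b.repr v j| ≤ M₂ * ‖v‖)
    (Rr : ℝ) (Hp Hg : Prop) :
    letI : CStarAlgebra (Matrix (Fin 2) (Fin 2) ℂ) := {}
    ∃ d' A₀ : ℕ, ∀ a' : ℕ, A₀ ≤ a' → ∃ cP : ℝ, 0 < cP ∧ ∀ BE : ℝ, 0 < BE → ∃ aJ : ℝ, 0 < aJ ∧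
    ∀ aT : ℝ, 0 < aT → aT ≤ alphaQ (2 + 1) (ℓ + 1) / ((ℓ + 1 : ℕ) : ℝ) ^ 2 → C0 (2 + 1) * aT ≤ 1 / 3 → 2 * aT ≤ c2' (2 + 1) (ℓ + 1) →
      2 * ((48 * (((2 : ℕ) : ℝ) + 1) + 14 * ((2 : ℕ) : ℝ) * M + (32 * (((2 : ℕ) : ℝ) + 2) ^ 2 +
        12 * (((2 : ℕ) : ℝ) + 1) ^ 2 * (13344 * (((2 : ℕ) : ℝ) + 1) * (((2 : ℕ) : ℝ) + 2) ^ 2 * (((2 : ℕ) : ℝ) + 5) * (((ℓ + 1 : ℕ) : ℝ)) ^ (2 + 4)) *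
          (Cτ * betaTau τ))) * aT) * (2 * (BE * B6.c1 d' δE (1 - α) * (((ℓ + 1 : ℕ) : ℝ)) ^ 4)) ≤ 1 →
      aT ≤ cP →
    ∀ α₀' : ℝ, 0 < α₀' → α₀' ≤ aJ → C0 (2 + 1) * α₀' ≤ 1 / 3 → 2 * α₀' ≤ c2' (2 + 1) (ℓ + 1) → aT * (((ℓ + 1 : ℕ) : ℝ)) ^ (2 * 1) < α₀' →
    ∃ a₀' : ℝ, 0 < a₀' ∧ ∃ k₀ : ℕ, ∃ cα : ℝ, 0 < cα ∧
    ∀ cL : ℝ, 0 < cL → cL * (((ℓ + 1 : ℕ) : ℝ)) ^ 2 < a₀' →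
      cL ≤ min (1 / 16) (min aT (min aT (1 / (2 * (2 * (2 * (BE * B6.c1 d' δE (1 - α) * (((ℓ + 1 : ℕ) : ℝ)) ^ 4))) * (14 * ((2 + 1 - 1 : ℕ) : ℝ)) * M + 1)))) →
      cL ≤ cα →
    ∃ B₁' B₂ c₁ : ℝ, 0 < B₁' ∧ 0 < B₂ ∧ 0 < c₁ ∧
    ∀ F : T3Family, F.L = ℓ + 1 → ∀ (n K : ℕ), n < K →
      (∀ (i : KIdx 2 ℓ hd₃ hL 1 1) (m' : ℕ), 1 ≤ m' → m' ≤ K - n → i.k = m' + 1 → (∀ x, i.D.lev x = m') → i.Mh = (ℓ + 1) ^ a' →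
        i.cf = (((ℓ + 1 : ℕ) : ℝ)) ^ (m' + 1) →
        (∀ ι : IBondY i, i.w ι = i.cf ^ 2 * (((((ℓ + 1 : ℕ) : ℝ)) ^ (ι.1.1 : ℕ)) ^ (2 + 1) * (1 / (((ℓ + 1 : ℕ) : ℝ)) ^ (ι.1.1 : ℕ)) ^ 2)) →
        (PV 2 ℓ i.m i.K hd₃ hL).sitesPerDir 0 = (PV 2 ℓ (F.m + k₀) K hd₃ hL).sitesPerDir 0 →
        ∀ (α₀ : ℝ) (U₀ : LSite (2 + 1) → Fin (2 + 1) → (Matrix (Fin 2) (Fin 2) ℂ)ˣ),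
        (∀ x κ, U₀ x κ ∈ B7Prop2Explicit.unitaryUnits (Matrix (Fin 2) (Fin 2) ℂ)) →
        IsPeriodic ((PV 2 ℓ (F.m + k₀) K hd₃ hL).sitesPerDir 0) U₀ → 0 < α₀ → α₀ ≤ aT →
        InAk (ℓ + 1) m' (eta F n K) α₀ (fun _ => (Set.univ : Set (LSite (2 + 1)))) U₀ →
          IsUnit (deltaAY i (parSymY i) (parBY i) (GpY i (parSymY i)) (bgY i U₀)) ∧
          (∀ (B : B9.Backgrounds) (cfg : B.Cfg → CfgY (Matrix (Fin 2) (Fin 2) ℂ) i) (par : BondParY (Matrix (Fin 2) (Fin 2) ℂ) i) (U₁ : B.Cfg),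
            cfg U₁ = bgY i U₀ →
            EBlock (kernelFamilyBInv i B cfg (GAY i (parSymY i) (parBY i) (GpY i (parSymY i))) par) BE δE U₁)) →
      (((F.P K).sitesPerDir 0 : ℕ) : ℤ) ∣ (((PV 2 ℓ (F.m + k₀) K hd₃ hL).sitesPerDir 0 : ℕ) : ℤ) ∧
      (((ℓ + 1 : ℕ) : ℤ)) ^ (K - n) ∣ (((F.P K).sitesPerDir 0 : ℕ) : ℤ) ∧
      Thm2TorusAt (ℓ + 1) (K - n) ((((PV 2 ℓ (F.m + k₀) K hd₃ hL).sitesPerDir 0 : ℕ) : ℤ)) (eta F n K) 0 B₁' B₂ c₁ len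
        (specialUnitaryUnits (Fin 2)) (fun _ => True) := by
  letI : CStarAlgebra (Matrix (Fin 2) (Fin 2) ℂ) := {}
  haveI : Nonempty (Fin 2) := ⟨0⟩
  have hℓ1 : 1 ≤ ℓ := by omega
  -- p33 FILE 9 at `G := U(2)`: `(δ_G, K_G)`, thresholds, `a₁(9)`
  obtain ⟨δG, KG, M₉, T₉, N₉, hδG, hKG, a₉, ha₉, H9⟩ :=
    eBlock_GpY_of_cubeData_unitary (d := 2) (hd := hd₃) (hL := hL) (b₀ := 1) (b₁ := 1) b (G := unitaryUnits (Matrix (Fin 2) (Fin 2) ℂ)) le_rfl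
      (fun _ => (1 : ℝ)) (fun _ => Hg) hℓ1 hM₂ hrepr
  -- p21 FILE 10-D at `G := U(2)`: `(δ_C, K_T)`, thresholds, `a₁(10)`
  obtain ⟨δC, KT, M₁₀, T₁₀, N₁₀, hδC, hKT, a₁₀, ha₁₀, H10⟩ :=
    cinv_at_member_of_cubeData_thmD (d := 2) (hd := hd₃) (hL := hL) (b₀ := 1) (b₁ := 1) b (G := unitaryUnits (Matrix (Fin 2) (Fin 2) ℂ)) le_rfl
      (fun _ => (1 : ℝ)) (fun _ => Hg) hℓ1 hM₂ hrepr
  -- the common rate `δ₀ := min δ_G δ_C`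
  have hδ₀ : 0 < min δG δC := lt_min hδG hδC
  -- the form of record at `(δ₀, K_G, K_T)`
  obtain ⟨d', A₀, HF⟩ := hThm2Cover_of_prop6_eBlockSymG_final (hd₃ := hd₃) (hL := hL) (len := len) hℓ τ hτ hτt hCτ hM1 hδE hαE0 hα1 b hM₂ hrepr
    Rr Hp Hg hδ₀ hKG hKT
  -- §2: the suppliers' member thresholds above one exponent
  obtain ⟨A₁, HA₁⟩ := exists_threshold_exponent (d := 2) (hd := hd₃) (hL := hL) (b₀ := (1 : ℝ)) (b₁ := (1 : ℝ)) (by omega : 2 ≤ ℓ)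
    (max M₉ M₁₀) (max T₉ T₁₀) (max N₉ N₁₀)
  refine ⟨d', max A₀ A₁, fun a' ha' => ?_⟩
  -- §1: Prop. 6's smallness at `M_h = L^{a′}` for the size `a₁ := min a₁(9) a₁(10)`
  obtain ⟨cP, hcP, HP⟩ := exists_cubeData_of_prop6 (N := 2) (d := 2) (hd := hd₃) (hL := hL) (b₀ := (1 : ℝ)) (b₁ := (1 : ℝ)) (by norm_num) hℓ a'
    (lt_min ha₉ ha₁₀)
  refine ⟨cP, hcP, fun BE hBE => ?_⟩
  obtain ⟨aJ, haJ, HJ⟩ := HF a' ((le_max_left _ _).trans ha') BE hBE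
  refine ⟨aJ, haJ, fun aT haT haTQ haT3 haT2 hεB haTP α₀' hα₀ hα₀le hα₀3 hα₀2 hslack => ?_⟩
  obtain ⟨a₀', ha₀', k₀, cα, hcα, HC⟩ := HJ aT haT haTQ haT3 haT2 hεB α₀' hα₀ hα₀le hα₀3 hα₀2 hslack
  refine ⟨a₀', ha₀', k₀, cα, hcα, fun cL hcL hαe hcLP hcLα => ?_⟩
  obtain ⟨B₁', B₂, c₁, hB₁', hB₂, hc₁, HT⟩ := HC cL hcL hαe hcLP hcLα
  refine ⟨B₁', B₂, c₁, hB₁', hB₂, hc₁, fun F hF n K hnK h12 => HT F hF n K hnK ?_⟩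
  -- the four-member binder of the form of record from the two-member one + Prop. 6 + FILE 9 + FILE 10-D
  intro i m' h1 hmK hk hD hMh hcf hw hper α₀ U₀ hU₀ hU₀per hα₀0 hα₀T hAk
  obtain ⟨h1s, hEs⟩ := h12 i m' h1 hmK hk hD hMh hcf hw hper α₀ U₀ hU₀ hU₀per hα₀0 hα₀T hAk
  -- the suppliers' thresholds at this member
  obtain ⟨hMm, hNm, hTm⟩ := HA₁ a' ((le_max_right _ _).trans ha') i hMh
  have hM₉ : M₉ ≤ ((ℓ : ℝ) + 1) * (toKT i).Mh := (le_max_left _ _).trans hMm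
  have hM₁₀ : M₁₀ ≤ ((ℓ : ℝ) + 1) * (toKT i).Mh := (le_max_right _ _).trans hMm
  have hN₉ : N₉ + 1 ≤ (toKT i).R * ((ℓ + 1) * (toKT i).Mh) := (Nat.add_le_add_right (le_max_left _ _) 1).trans hNm
  have hN₁₀ : N₁₀ + 1 ≤ (toKT i).R * ((ℓ + 1) * (toKT i).Mh) := (Nat.add_le_add_right (le_max_right _ _) 1).trans hNm
  have hT₉ : T₉ ≤ B9CubeGeometryInputs.RM1 i := (le_max_left _ _).trans hTm
  have hT₁₀ : T₁₀ ≤ B9CubeGeometryInputs.RM1 i := (le_max_right _ _).trans hTm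
  have hcfk : i.cf = (((ℓ + 1 : ℕ) : ℝ)) ^ i.k := by rw [hk]; exact hcf
  -- a section of the member's carrier-block map (G9 §1)
  have hsurj : Function.Surjective (β i.hN i.D i.hk) := surjective_beta_kIdx_of_constLev i hk hD
  have hι : ∀ s : BlkY i, β i.hN i.D i.hk (Function.surjInv hsurj s) = s := fun s => Function.surjInv_eq hsurj s
  -- the member background is `U(2)`-valued and `P′`-periodic in the member's letter
  have hU : ∀ μ x, bgY i U₀ μ x ∈ unitaryUnits (Matrix (Fin 2) (Fin 2) ℂ) := bgY_mem i hU₀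
  have hU₀per' : ∀ (x : LSite (2 + 1)) (μ : Fin (2 + 1)), U₀ (x + (((PV 2 ℓ i.m i.K hd₃ hL).sitesPerDir 0 : ℕ) : ℤ) • e μ) = U₀ x := by
    rw [hper]; exact fun x μ => hU₀per x (e μ)
  -- §1: the per-cube (3.35) data for `bgY i U₀` from Prop. 6
  obtain ⟨g, A, Q, C, ξ, Λ, hg, hC0, hξ, hΛ, hξS, hΛξ, hQ, hgA, hAb, hdA, hs₁, hs₄⟩ :=
    HP i m' hD hk hMh (eta F n K) α₀ U₀ hU₀ hU₀per' (eta_pos F n K) hα₀0 (hα₀T.trans haTP) hAk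
  have hs₉ : ∀ c, max (C c) (C c * (1 + B4PartitionUnity22.D1 B4PartitionUnity22.thetaProf)) * Λ c ^ 2 ≤ a₉ :=
    fun c => (hs₁ c).trans (min_le_left _ _)
  have hs₁₀ : ∀ c, max (C c) (C c * (1 + B4PartitionUnity22.D1 B4PartitionUnity22.thetaProf)) * Λ c ^ 2 ≤ a₁₀ :=
    fun c => (hs₁ c).trans (min_le_right _ _)
  refine ⟨h1s, hEs, ?_, ?_⟩
  · -- (Gₛ): FILE 9 at the caller's background family, rate weakened to `δ₀`
    intro B cfg U₁ hcfg
    have hE := (H9 i hM₉ hN₉ hT₉ hcfk (Function.surjInv hsurj) hι (bgY i U₀) hU g hg A Q C ξ Λ hC0 hξ hΛ hξS hΛξ hQ hgA hAb hdA hs₉ hs₄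
      cfg U₁ hcfg).1
    exact eBlock_mono' i _ le_rfl (min_le_left _ _) hKG hE
  · -- (Cₛ): FILE 10-D at the given section and the one-point family, rate weakened to `δ₀`
    intro ιB hιB
    let B : B9.Backgrounds :=
      { Cfg := Unit, one := (), mul := fun _ _ => (), Reg335 := fun _ _ _ => True, Reg336 := fun _ _ _ => True,
        Cplx337 := fun _ _ _ => True, Cplx338 := fun _ _ _ => True }
    have hC := H10 i hM₁₀ hN₁₀ hT₁₀ hcfk ιB hιB (bgY i U₀) hU g hg A Q C ξ Λ hC0 hξ hΛ hξS hΛξ hQ hgA hAb hdA hs₁₀ hs₄ (B := B)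
      (fun _ => bgY i U₀) () rfl
    refine hasMajorant_mono (g := toB6 (geo9K i) 1 Hg) _ hC fun a a'' => ?_
    have hlen : 0 ≤ ((geo9K i).len a ^ 4)⁻¹ := inv_nonneg.2 (pow_nonneg (B6KLevelCensusIndexV1.len_pos i a).le 4)
    have hdist := geo9K_dist_nonneg' i a a''
    have hexp : Real.exp (-(δC * (geo9K i).dist a a'')) ≤ Real.exp (-(min δG δC * (geo9K i).dist a a'')) :=
      Real.exp_le_exp.2 (by nlinarith [min_le_right δG δC, mul_le_mul_of_nonneg_right (min_le_right δG δC) hdist])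
    exact mul_le_mul_of_nonneg_left hexp (mul_nonneg hKT hlen)

end Cover

/-! ## §4 ★ The displayed `a_T` ∕ `α₀′` windows, with the new `a_T ≤ c_P`, are jointly inhabited -/

/-- **NON-VACUITY OF THE SIZE WINDOWS** of `hThm2Cover_of_prop6_deltaAMembers`: for every junction class size `a_J > 0`, every Prop.-6 size `c_P > 0` and every pair
of reals `S, B` (the ε-window's bracket and `2B₀`), there are `α₀′` and `a_T` with ALL displayed window conditions — t2s-1 g10's
`B8Thm2TorusCoverJunctionWindows.exists_admissible_sizes` construction with `a_T` cut down by one more `min … c_P`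
(`α₀′ = min (a_J, 1∕(3C₀), c₂′∕2)`, `a_T = min (α₀′∕(2L²), α_Q∕L², 1∕(2(max(SB,0)+1)), c_P)`).
[cite: Balaban1985RegularSpaces, Prop. 6 p.99 («for α₀ sufficiently small»), (1.7) p.77, Thm 2 p.83; Balaban1985Averaging, Prop. 2 p.26, bookkeeping] -/
theorem exists_admissible_sizes_below (d : ℕ) {L : ℕ} (hL : 1 ≤ L) (S B : ℝ) {aJ cP : ℝ} (haJ : 0 < aJ) (hcP : 0 < cP) :
    ∃ α₀' aT : ℝ, 0 < aT ∧ aT ≤ B9Eq316AveragingTransposeZd.alphaQ d L / (L : ℝ) ^ 2 ∧ B7Prop2Explicit.C0 d * aT ≤ 1 / 3 ∧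
      2 * aT ≤ B7Prop2Explicit.c2' d L ∧ 2 * (S * aT) * B ≤ 1 ∧ aT ≤ cP ∧
      0 < α₀' ∧ α₀' ≤ aJ ∧ B7Prop2Explicit.C0 d * α₀' ≤ 1 / 3 ∧ 2 * α₀' ≤ B7Prop2Explicit.c2' d L ∧ aT * (L : ℝ) ^ (2 * 1) < α₀' := by
  -- t2s-1 g10's construction (`B8Thm2TorusCoverJunctionWindows.exists_admissible_sizes`) with one more `min`
  have hC0 := B7Prop2Explicit.C0_pos d
  have hc2 := B7Prop2Explicit.c2'_pos d L hL
  have hαQ := B9Eq316AveragingTransposeZd.alphaQ_pos d hL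
  have hL1 : (1 : ℝ) ≤ (L : ℝ) := by exact_mod_cast hL
  have hLpos : (0 : ℝ) < (L : ℝ) := by linarith
  have hL2 : (1 : ℝ) ≤ (L : ℝ) ^ 2 := by nlinarith
  obtain ⟨α, hαdef⟩ : ∃ α : ℝ, α = min aJ (min (1 / (3 * B7Prop2Explicit.C0 d)) (B7Prop2Explicit.c2' d L / 2)) := ⟨_, rfl⟩
  have hαpos : 0 < α := by rw [hαdef]; exact lt_min haJ (lt_min (by positivity) (by positivity))
  have hα1 : α ≤ aJ := by rw [hαdef]; exact min_le_left _ _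
  have hα2 : α ≤ 1 / (3 * B7Prop2Explicit.C0 d) := by rw [hαdef]; exact (min_le_right _ _).trans (min_le_left _ _)
  have hα3 : α ≤ B7Prop2Explicit.c2' d L / 2 := by rw [hαdef]; exact (min_le_right _ _).trans (min_le_right _ _)
  obtain ⟨Φ, hΦdef⟩ : ∃ Φ : ℝ, Φ = max (S * B) 0 := ⟨_, rfl⟩
  have hΦ0 : 0 ≤ Φ := by rw [hΦdef]; exact le_max_right _ _
  have hSB : S * B ≤ Φ := by rw [hΦdef]; exact le_max_left _ _
  obtain ⟨a, hadef⟩ : ∃ a : ℝ,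
      a = min (α / (2 * (L : ℝ) ^ 2)) (min (B9Eq316AveragingTransposeZd.alphaQ d L / (L : ℝ) ^ 2) (min (1 / (2 * (Φ + 1))) cP)) := ⟨_, rfl⟩
  have hapos : 0 < a := by rw [hadef]; exact lt_min (by positivity) (lt_min (by positivity) (lt_min (by positivity) hcP))
  have ha1 : a ≤ α / (2 * (L : ℝ) ^ 2) := by rw [hadef]; exact min_le_left _ _
  have ha2 : a ≤ B9Eq316AveragingTransposeZd.alphaQ d L / (L : ℝ) ^ 2 := by rw [hadef]; exact (min_le_right _ _).trans (min_le_left _ _)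
  have ha3 : a ≤ 1 / (2 * (Φ + 1)) := by rw [hadef]; exact (min_le_right _ _).trans ((min_le_right _ _).trans (min_le_left _ _))
  have ha4 : a ≤ cP := by rw [hadef]; exact (min_le_right _ _).trans ((min_le_right _ _).trans (min_le_right _ _))
  have haL : a * (L : ℝ) ^ (2 * 1) ≤ α / 2 := by
    rw [show (2 * 1 : ℕ) = 2 from rfl]
    calc a * (L : ℝ) ^ 2 ≤ α / (2 * (L : ℝ) ^ 2) * (L : ℝ) ^ 2 := mul_le_mul_of_nonneg_right ha1 (by positivity)
      _ = α / 2 := by field_simp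
  have hL2' : (1 : ℝ) ≤ (L : ℝ) ^ (2 * 1) := by rw [show (2 * 1 : ℕ) = 2 from rfl]; exact hL2
  have haα : a ≤ α / 2 := (le_mul_of_one_le_right hapos.le hL2').trans haL
  refine ⟨α, a, hapos, ha2, ?_, ?_, ?_, ha4, hαpos, hα1, ?_, ?_, ?_⟩
  · have h : a ≤ 1 / (3 * B7Prop2Explicit.C0 d) := haα.trans ((half_le_self hαpos.le).trans hα2)
    calc B7Prop2Explicit.C0 d * a ≤ B7Prop2Explicit.C0 d * (1 / (3 * B7Prop2Explicit.C0 d)) := mul_le_mul_of_nonneg_left h hC0.le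
      _ = 1 / 3 := by field_simp
  · linarith [haα, hα3, hc2]
  · have h1 : a * Φ ≤ 1 / 2 := B9Thm32CinvAtKnitLetterOfCubeData.small_of_le hΦ0 ha3
    have h2 : a * (S * B) ≤ a * Φ := mul_le_mul_of_nonneg_left hSB hapos.le
    have h3 : 2 * (S * a) * B = 2 * (a * (S * B)) := by ring
    linarith [h1, h2, h3]
  · calc B7Prop2Explicit.C0 d * α ≤ B7Prop2Explicit.C0 d * (1 / (3 * B7Prop2Explicit.C0 d)) := mul_le_mul_of_nonneg_left hα2 hC0.le
      _ = 1 / 3 := by field_simp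
  · linarith [hα3]
  · exact lt_of_le_of_lt haL (half_lt_self hαpos)

end Literature.MathematicalPhysics.QuantumFieldTheory.Balaban1983to89.B8Thm2TorusCoverGCOfProp6

end
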